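import Literature.NumberTheory.Weil1964.AdelicMetaplecticSumImplementer
import HarnessLib

/-!
# Weil's rational lift of a rational DIRECT SUM is the external tensor of the rational lifts:
# `ω(r_F(x₁ ⊕ x₂))(Φ₁ ⊠ Ψ₂) = ω(r_F x₁)Φ₁ ⊠ ω_{−T}(r_F x₂)Ψ₂`

Topic `NumberTheory/Weil1964`; namespace `Literature.NumberTheory.Weil1964`.  KERNEL MATHEMATICS ONLY (theorems; no definition,
no named fact, no proof hole).

[Weil1964, Chap. III n° 38 pp. 189–190] (the metaplectic representation of an orthogonal direct sum restricts to the external tensor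
over `Sp(W₁) × Sp(W₂)`) combined with [Weil1964, Chap. III n° 41 Thm 6 p. 193] (`r_F` is the unique `Θ`-fixing lift over the rational
points): for the DOUBLED space `W ⊕ W⁻` of the tree (`𝕋 = doubledGramFin F T` on `Fin (n + n)`), if a rational point `x ∈ Sp_{2(n+n)}(F)` of
`Sp(𝕎□_𝔸)` is the block-diagonal `ratSp x₁ ⊕ ratSp x₂` of two rational points of `Sp(W_𝔸)`, `Sp(W⁻_𝔸)`, then Weil's lift `r_F^□(x)`
acts on pure tensors EXACTLY as `r_F(x₁) ⊠ r_F(x₂)` — no scalar: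

* **`ratThetaLiftCont_eq_sumImplementer`** — `r_F^□(x)` IS the tensor implementer `k` of ★ `exists_sumImplementer` at `(r_F x₁, r_F x₂)`
  (both lie over the same symplectic element, so `k = c · r_F^□(x)` with `c ∈ ℂˣ` by ★ `exists_eq_ofScalar_of_proj_eq_one`; testing the theta
  distribution on ONE pure tensor with `Θ(A)Θ(A) ≠ 0` — `Θ(A ⊠ B) = Θ(A)Θ(B)` ★ `thetaDistLM_sumTensor_finSumFinEquiv_symm`, and all three
  lifts fix `Θ` ★ `thetaDist_omega_ratThetaLiftCont` — gives `c = 1`);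
* **`omega_ratThetaLiftCont_sumTensor_of_ratSp_eq`** — the operator statement above;
* `omega_ratThetaLiftCont_sumTensor_of_ratSp_eq_left` — the case `x₂ = 1`: `ω(r_F^□ x)(Φ₁ ⊠ Ψ₂) = ω(r_F x₁)Φ₁ ⊠ Ψ₂` (the shape consumed by
  the E-2 Siegel–Weil child's stub SW3: the doubled pair's `W`-member `ι(1 ⊗ (γ, 1))` acts on `Φ₁ ⊠ Φ̄₂` through the first factor only).

Proof terms are written as explicit `Eq.trans` chains (no `rw`/`simp` across the metaplectic carriers, whose unification is expensive).

## References
* [Weil1964] A. Weil, Sur certains groupes d'opérateurs unitaires, Acta Math. 111 (1964), Chap. III n° 38 pp. 189–190, n° 41 Thm 6 p. 193.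
* [MoeglinVignerasWaldspurger1987] C. Mœglin, M.-F. Vignéras, J.-L. Waldspurger, LNM 1291 (1987), Chap. 2 II.1 Rem. (6).
* [Kudla1994] S. S. Kudla, Israel J. Math. 87 (1994), §1.
-/

noncomputable section

open NumberField

namespace Literature.NumberTheory.Weil1964

open Literature.RepresentationTheory.HeisenbergGroup Literature.NumberTheory.Automorphic
open Literature.NumberTheory.Automorphic.UnitaryGroup (spReindex spSum)

section RationalSum

variable (F : Type) [Field F] [NumberField F] {n : ℕ}
variable (T : Matrix (Fin n) (Fin n) (AdeleRing (𝓞 F) F)) (hT : IsUnit T.det) (hT' : IsUnit (-T).det)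

include hT in
/-- **`r_F^□(x₁ ⊕ x₂)` IS the tensor implementer**: if `ratSp x = ratSp x₁ ⊕ ratSp x₂` (read on `Fin (n + n)`), then any `k ∈ Mp_ψ((W ⊕ W⁻)_𝔸)ᶜᵒⁿᵗ`
over that element whose Weil operator is the external tensor `ω(r_F x₁) ⊠ ω_{−T}(r_F x₂)` on pure tensors equals Weil's `Θ`-fixing lift `r_F^□(x)`
(`k = c · r_F^□(x)`, and `Θ(A ⊠ A) = Θ(A)Θ(A) ≠ 0` for Weil's witness forces `c = 1`).
[cite: Weil1964, Chap. III n° 38 pp. 189–190 and n° 41 Thm 6 p. 193] -/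
theorem ratThetaLiftCont_eq_sumImplementer (x : Matrix.symplecticGroup (Fin (n + n)) F)
    (x₁ x₂ : Matrix.symplecticGroup (Fin n) F)
    (hx : ratSp F (doubledGramFin F T) (isUnit_det_doubledGramFin F T hT) x =
      spReindex finSumFinEquiv (Matrix.fromBlocks T 0 0 (-T)) (spSum T (-T) (ratSp F T hT x₁, ratSp F (-T) hT' x₂)))
    (k : adelicMpCont F (Fin (n + n)) (doubledGramFin F T))
    (hk : adelicMpCont.proj F (Fin (n + n)) (doubledGramFin F T) k =
      spReindex finSumFinEquiv (Matrix.fromBlocks T 0 0 (-T)) (spSum T (-T) (ratSp F T hT x₁, ratSp F (-T) hT' x₂)))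
    (hkω : ∀ (Φ₁ Ψ₂ : piSchwartzBruhat F (Fin n)),
      adelicMpCont.omega F (Fin (n + n)) (doubledGramFin F T) k (sumTensor F finSumFinEquiv.symm Φ₁ Ψ₂) =
        sumTensor F finSumFinEquiv.symm (adelicMpCont.omega F (Fin n) T (ratThetaLiftCont F T hT x₁) Φ₁)
          (adelicMpCont.omega F (Fin n) (-T) (ratThetaLiftCont F (-T) hT' x₂) Ψ₂)) :
    k = ratThetaLiftCont F (doubledGramFin F T) (isUnit_det_doubledGramFin F T hT) x := by
  -- `k` and `q := r_F^□(x)` lie over the same symplectic element `S`, so `k = c · q`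
  have hq : adelicMpCont.proj F (Fin (n + n)) (doubledGramFin F T)
      (ratThetaLiftCont F (doubledGramFin F T) (isUnit_det_doubledGramFin F T hT) x) =
      spReindex finSumFinEquiv (Matrix.fromBlocks T 0 0 (-T)) (spSum T (-T) (ratSp F T hT x₁, ratSp F (-T) hT' x₂)) :=
    (proj_ratThetaLiftCont F (doubledGramFin F T) (isUnit_det_doubledGramFin F T hT) x).trans hx
  have hproj : adelicMpCont.proj F (Fin (n + n)) (doubledGramFin F T)
      (k * (ratThetaLiftCont F (doubledGramFin F T) (isUnit_det_doubledGramFin F T hT) x)⁻¹) = 1 :=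
    ((adelicMpCont.proj F (Fin (n + n)) (doubledGramFin F T)).map_mul k _).trans
      ((congrArg₂ (· * ·) hk (((adelicMpCont.proj F (Fin (n + n)) (doubledGramFin F T)).map_inv _).trans
        (congrArg (·⁻¹) hq))).trans (mul_inv_cancel _))
  refine (adelicMpCont.exists_eq_ofScalar_of_proj_eq_one
    ((Matrix.isUnit_iff_isUnit_det _).mpr (isUnit_det_doubledGramFin F T hT))
    (k * (ratThetaLiftCont F (doubledGramFin F T) (isUnit_det_doubledGramFin F T hT) x)⁻¹) hproj).elim fun c hc => ?_
  have hkq : k = adelicMpCont.ofScalar F (Fin (n + n)) (doubledGramFin F T) c *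
      ratThetaLiftCont F (doubledGramFin F T) (isUnit_det_doubledGramFin F T hT) x :=
    mul_inv_eq_iff_eq_mul.1 hc
  -- `ω(k) Ψ = c • ω(q) Ψ`
  have hω : ∀ Ψ : piSchwartzBruhat F (Fin (n + n)),
      adelicMpCont.omega F (Fin (n + n)) (doubledGramFin F T) k Ψ =
        (c : ℂ) • adelicMpCont.omega F (Fin (n + n)) (doubledGramFin F T)
          (ratThetaLiftCont F (doubledGramFin F T) (isUnit_det_doubledGramFin F T hT) x) Ψ := fun Ψ =>
    (congrArg (fun t => adelicMpCont.omega F (Fin (n + n)) (doubledGramFin F T) t Ψ) hkq).trans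
      ((adelicMpCont.omega_mul_apply F (doubledGramFin F T) _ _ Ψ).trans (adelicMpCont.omega_ofScalar c _))
  -- test the theta distribution on the pure tensor `A ⊠ A` with `Θ(A) ≠ 0`
  refine (exists_thetaDistLM_ne_zero F (Fin n)).elim fun A hA => ?_
  have hΘ₁ : thetaDistLM F (Fin n) (adelicMpCont.omega F (Fin n) T (ratThetaLiftCont F T hT x₁) A) = thetaDistLM F (Fin n) A :=
    thetaDist_omega_ratThetaLiftCont F T hT x₁ A
  have hΘ₂ : thetaDistLM F (Fin n) (adelicMpCont.omega F (Fin n) (-T) (ratThetaLiftCont F (-T) hT' x₂) A) = thetaDistLM F (Fin n) A :=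
    thetaDist_omega_ratThetaLiftCont F (-T) hT' x₂ A
  have hΘq : thetaDistLM F (Fin (n + n)) (adelicMpCont.omega F (Fin (n + n)) (doubledGramFin F T)
      (ratThetaLiftCont F (doubledGramFin F T) (isUnit_det_doubledGramFin F T hT) x) (sumTensor F finSumFinEquiv.symm A A)) =
      thetaDistLM F (Fin (n + n)) (sumTensor F finSumFinEquiv.symm A A) :=
    thetaDist_omega_ratThetaLiftCont F (doubledGramFin F T) (isUnit_det_doubledGramFin F T hT) x _
  have h1 : thetaDistLM F (Fin (n + n)) (adelicMpCont.omega F (Fin (n + n)) (doubledGramFin F T) k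
      (sumTensor F finSumFinEquiv.symm A A)) = thetaDistLM F (Fin n) A * thetaDistLM F (Fin n) A :=
    (congrArg (thetaDistLM F (Fin (n + n))) (hkω A A)).trans
      ((thetaDistLM_sumTensor_finSumFinEquiv_symm F _ _).trans (congrArg₂ (· * ·) hΘ₁ hΘ₂))
  have h2 : thetaDistLM F (Fin (n + n)) (adelicMpCont.omega F (Fin (n + n)) (doubledGramFin F T) k
      (sumTensor F finSumFinEquiv.symm A A)) = (c : ℂ) * (thetaDistLM F (Fin n) A * thetaDistLM F (Fin n) A) :=
    (congrArg (thetaDistLM F (Fin (n + n))) (hω _)).trans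
      ((LinearMap.map_smul (thetaDistLM F (Fin (n + n))) (c : ℂ) _).trans
        ((smul_eq_mul _ _).trans (congrArg (fun t => (c : ℂ) * t)
          (hΘq.trans (thetaDistLM_sumTensor_finSumFinEquiv_symm F A A)))))
  have hc1 : (c : ℂ) = 1 :=
    mul_right_cancel₀ (mul_ne_zero hA hA) ((h2.symm.trans h1).trans (one_mul _).symm)
  have hc1' : c = 1 := Units.val_eq_one.1 hc1
  exact hkq.trans ((congrArg (fun t => adelicMpCont.ofScalar F (Fin (n + n)) (doubledGramFin F T) t *
    ratThetaLiftCont F (doubledGramFin F T) (isUnit_det_doubledGramFin F T hT) x) hc1').trans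
      ((congrArg (· * ratThetaLiftCont F (doubledGramFin F T) (isUnit_det_doubledGramFin F T hT) x)
        (map_one (adelicMpCont.ofScalar F (Fin (n + n)) (doubledGramFin F T)))).trans (one_mul _)))

include hT in
/-- **`ω(r_F^□(x₁ ⊕ x₂))(Φ₁ ⊠ Ψ₂) = ω(r_F x₁)Φ₁ ⊠ ω_{−T}(r_F x₂)Ψ₂`**: over a rational block-diagonal point of `Sp((W ⊕ W⁻)_𝔸)` Weil's lift acts
on pure tensors as the external tensor of the two rational lifts — EXACTLY, with no scalar (restriction to a direct sum, n° 38, plus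
`Θ`-rigidity of `r_F`, Thm 6). [cite: Weil1964, Chap. III n° 38 pp. 189–190 and n° 41 Thm 6 p. 193] -/
theorem omega_ratThetaLiftCont_sumTensor_of_ratSp_eq (x : Matrix.symplecticGroup (Fin (n + n)) F)
    (x₁ x₂ : Matrix.symplecticGroup (Fin n) F)
    (hx : ratSp F (doubledGramFin F T) (isUnit_det_doubledGramFin F T hT) x =
      spReindex finSumFinEquiv (Matrix.fromBlocks T 0 0 (-T)) (spSum T (-T) (ratSp F T hT x₁, ratSp F (-T) hT' x₂)))
    (Φ₁ Ψ₂ : piSchwartzBruhat F (Fin n)) :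
    adelicMpCont.omega F (Fin (n + n)) (doubledGramFin F T)
        (ratThetaLiftCont F (doubledGramFin F T) (isUnit_det_doubledGramFin F T hT) x) (sumTensor F finSumFinEquiv.symm Φ₁ Ψ₂) =
      sumTensor F finSumFinEquiv.symm (adelicMpCont.omega F (Fin n) T (ratThetaLiftCont F T hT x₁) Φ₁)
        (adelicMpCont.omega F (Fin n) (-T) (ratThetaLiftCont F (-T) hT' x₂) Ψ₂) := by
  refine (exists_sumImplementer F T hT (ratThetaLiftCont F T hT x₁) (ratThetaLiftCont F (-T) hT' x₂)).elim fun k hk => ?_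
  have hk1 : adelicMpCont.proj F (Fin (n + n)) (doubledGramFin F T) k =
      spReindex finSumFinEquiv (Matrix.fromBlocks T 0 0 (-T)) (spSum T (-T) (ratSp F T hT x₁, ratSp F (-T) hT' x₂)) :=
    hk.1.trans (congrArg (spReindex finSumFinEquiv (Matrix.fromBlocks T 0 0 (-T)))
      (congrArg (spSum T (-T)) (Prod.ext (proj_ratThetaLiftCont F T hT x₁) (proj_ratThetaLiftCont F (-T) hT' x₂))))
  have hkq := ratThetaLiftCont_eq_sumImplementer F T hT hT' x x₁ x₂ hx k hk1 hk.2
  exact (congrArg (fun t => adelicMpCont.omega F (Fin (n + n)) (doubledGramFin F T) t (sumTensor F finSumFinEquiv.symm Φ₁ Ψ₂))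
    hkq).symm.trans (hk.2 Φ₁ Ψ₂)

include hT in
/-- **the case `x₂ = 1`**: if `ratSp x = ratSp x₁ ⊕ 1`, then `ω(r_F^□ x)(Φ₁ ⊠ Ψ₂) = ω(r_F x₁)Φ₁ ⊠ Ψ₂` — the doubled pair's `W`-member at a
rational point `(γ, 1)` acts on pure tensors through the first factor only (the shape of the E-2 Siegel–Weil child's stub SW3).
[cite: Weil1964, Chap. III n° 38 pp. 189–190 and n° 41 Thm 6 p. 193] [cite: Kudla1994, §1] -/
theorem omega_ratThetaLiftCont_sumTensor_of_ratSp_eq_left (x : Matrix.symplecticGroup (Fin (n + n)) F)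
    (x₁ : Matrix.symplecticGroup (Fin n) F)
    (hx : ratSp F (doubledGramFin F T) (isUnit_det_doubledGramFin F T hT) x =
      spReindex finSumFinEquiv (Matrix.fromBlocks T 0 0 (-T)) (spSum T (-T) (ratSp F T hT x₁, 1)))
    (Φ₁ Ψ₂ : piSchwartzBruhat F (Fin n)) :
    adelicMpCont.omega F (Fin (n + n)) (doubledGramFin F T)
        (ratThetaLiftCont F (doubledGramFin F T) (isUnit_det_doubledGramFin F T hT) x) (sumTensor F finSumFinEquiv.symm Φ₁ Ψ₂) =
      sumTensor F finSumFinEquiv.symm (adelicMpCont.omega F (Fin n) T (ratThetaLiftCont F T hT x₁) Φ₁) Ψ₂ := by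
  have hT' : IsUnit (-T).det := by
    rw [Matrix.det_neg]
    exact ((isUnit_one.neg).pow _).mul hT
  have hx' : ratSp F (doubledGramFin F T) (isUnit_det_doubledGramFin F T hT) x =
      spReindex finSumFinEquiv (Matrix.fromBlocks T 0 0 (-T)) (spSum T (-T) (ratSp F T hT x₁, ratSp F (-T) hT' 1)) :=
    hx.trans (congrArg (spReindex finSumFinEquiv (Matrix.fromBlocks T 0 0 (-T)))
      (congrArg (spSum T (-T)) (Prod.ext rfl (map_one (ratSp F (-T) hT')).symm)))
  refine (omega_ratThetaLiftCont_sumTensor_of_ratSp_eq F T hT hT' x x₁ 1 hx' Φ₁ Ψ₂).trans ?_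
  refine congrArg (sumTensor F finSumFinEquiv.symm (adelicMpCont.omega F (Fin n) T (ratThetaLiftCont F T hT x₁) Φ₁)) ?_
  exact (congrArg (fun t => adelicMpCont.omega F (Fin n) (-T) t Ψ₂) (map_one (ratThetaLiftCont F (-T) hT'))).trans
    ((congrArg (fun t : Module.End ℂ (piSchwartzBruhat F (Fin n)) => t Ψ₂) (map_one (adelicMpCont.omega F (Fin n) (-T)))).trans rfl)

end RationalSum

end Literature.NumberTheory.Weil1964

end
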